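import Summits.CriticalPhenomena.Ising3DConformalLimit.Theses.MonotoneBlocking
import Summits.CriticalPhenomena.Ising3DConformalLimit.Theorems.MonotoneBlockingTwo.Negative.AxiomaticsWitness
import HarnessLib

/-!
# `MonotoneBlockingTwo` (BM₂, item stmt-CriticalPhenomena-17054): an `ℓ∞`-ISOTROPIC kernel with the ISING AXIS
# PROFILE violates the inequality — the nearest-neighbour model's first-shell anisotropy is load-bearing

Negative / structural knowledge about the crux
`Summit.CriticalPhenomena.Ising3DConformalLimit.Theses.MonotoneBlocking.MonotoneBlockingTwo` (route
`MonotoneBlocking`), standing crux disprover, cycle 1 (D-0016). THEOREM-ONLY: the witness is written inline,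
`W₃(z) = w(‖z‖∞)` with `w(0) = 1`, `w(n) = 1/(3n)` (`‖z‖∞ = max |z 0| (max |z 1| |z 2|)`, ℕ-valued).

Its axis values `1/3n = 0.3333, 0.1667, 0.1111, …, 0.0556 (n = 6)` track the model's
`⟨σ₀σ_{ne₀}⟩_{β_c(3)} = 0.3302, 0.1627, 0.1040, …, 0.0512` to 8 %; it is positive, `≤ 1 = W₃(0)`, even, `‖·‖∞`-radially
non-increasing, has both power envelopes and `χ = ∞` (as `W` of `…/Negative/AxiomaticsWitness.lean`). Its first
shell is FLAT (`W₃(1,1,1) = W₃(1,1,0) = W₃(1,0,0) = 1/3`), where the model has `0.165 : 0.210 : 0.330`.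

* `axisWitness_not_shape`: the BM₂ shape (the route's `bc`, verbatim, with `W₃` for `criticalTwoPoint 3`) FAILS at
  `L = 1`, `k = (1,1,1)` by `80/9 > 79/9` (1.25 %): `W₃(1,1,1)·C(2,0) = (1/3)(80/3)` against `C(2,(1,1,1)) = 79/9`.
* `card_pairs_shell0/1`, `card_pairs_diag_shell1/2/3`: the exact shell counts `8, 56` of `x − y` and `1, 26, 37`
  of `(2,2,2) + x − y` over `x, y ∈ {0,1}³`, kernel-DECIDED; `blockSum_two_zero = 80/3`, `blockSum_two_diag = 79/9`.

In the model the same instance reads `⟨σ₀σ_{(1,1,1)}⟩·⟨S_2²⟩ ≈ 0.165·22.3 = 3.7 ≤ ⟨S_2(0)S_2((2,2,2))⟩ ≈ 5.8` and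
passes ONLY through the DIAGONAL DEFICITS `⟨σ₀σ_{(1,1,1)}⟩/⟨σ₀σ_{(1,0,0)}⟩ ≈ 0.50`, `⟨σ₀σ_{(1,1,0)}⟩/⟨σ₀σ_{(1,0,0)}⟩
≈ 0.63` (MC, crux dir `NUMERICS-r1-ideator1.md` §2): a proof of BM₂ must consume these numbers — neither an
axis profile nor any qualitative two-point feature suffices (companion of `SummableRigidity` — `χ = ∞` is
necessary — and `AxiomaticsWitness` — it is not sufficient).
-/

noncomputable section

namespace Summit.CriticalPhenomena.Ising3DConformalLimit.MonotoneBlockingTwoNegative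

open Literature.Probability.LatticeModels Finset
open scoped BigOperators
open Summit.CriticalPhenomena.Ising3DConformalLimit.Cruxes.ExistsScaleCovariantLimit.MonotoneBlockingPort
  (cube mem_cube card_cube cube_zero)

/-! ### Kernel-decided shell counts over `cube 2 × cube 2` -/

/-- The differences `x − y`, `x, y ∈ {0,1}³`, have `‖·‖∞ ∈ {0, 1}`. [folklore] -/
theorem image_sup_pairs :
    ((cube 2 ×ˢ cube 2).image fun p : Site 3 × Site 3 =>
      max ((p.1 - p.2) 0).natAbs (max ((p.1 - p.2) 1).natAbs ((p.1 - p.2) 2).natAbs)) = {0, 1} := by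
  decide

/-- `8` diagonal pairs. [folklore] -/
theorem card_pairs_shell0 :
    ((cube 2 ×ˢ cube 2).filter fun p : Site 3 × Site 3 =>
      max ((p.1 - p.2) 0).natAbs (max ((p.1 - p.2) 1).natAbs ((p.1 - p.2) 2).natAbs) = 0).card = 8 := by
  decide

/-- `56` pairs on the first shell. [folklore] -/
theorem card_pairs_shell1 :
    ((cube 2 ×ˢ cube 2).filter fun p : Site 3 × Site 3 =>
      max ((p.1 - p.2) 0).natAbs (max ((p.1 - p.2) 1).natAbs ((p.1 - p.2) 2).natAbs) = 1).card = 56 := by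
  decide

/-- The shifted differences `(2,2,2) + x − y` have `‖·‖∞ ∈ {1, 2, 3}`. [folklore] -/
theorem image_sup_pairs_diag :
    ((cube 2 ×ˢ cube 2).image fun p : Site 3 × Site 3 =>
      max (((2:ℤ) • (fun _ => (1:ℤ) : Site 3) + p.1 - p.2) 0).natAbs
        (max (((2:ℤ) • (fun _ => (1:ℤ) : Site 3) + p.1 - p.2) 1).natAbs
          (((2:ℤ) • (fun _ => (1:ℤ) : Site 3) + p.1 - p.2) 2).natAbs)) = {1, 2, 3} := by
  decide

/-- `1` shifted pair on shell `1` (namely `x = 0`, `y = (1,1,1)`). [folklore] -/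
theorem card_pairs_diag_shell1 :
    ((cube 2 ×ˢ cube 2).filter fun p : Site 3 × Site 3 =>
      max (((2:ℤ) • (fun _ => (1:ℤ) : Site 3) + p.1 - p.2) 0).natAbs
        (max (((2:ℤ) • (fun _ => (1:ℤ) : Site 3) + p.1 - p.2) 1).natAbs
          (((2:ℤ) • (fun _ => (1:ℤ) : Site 3) + p.1 - p.2) 2).natAbs) = 1).card = 1 := by
  decide

/-- `26` shifted pairs on shell `2`. [folklore] -/
theorem card_pairs_diag_shell2 :
    ((cube 2 ×ˢ cube 2).filter fun p : Site 3 × Site 3 =>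
      max (((2:ℤ) • (fun _ => (1:ℤ) : Site 3) + p.1 - p.2) 0).natAbs
        (max (((2:ℤ) • (fun _ => (1:ℤ) : Site 3) + p.1 - p.2) 1).natAbs
          (((2:ℤ) • (fun _ => (1:ℤ) : Site 3) + p.1 - p.2) 2).natAbs) = 2).card = 26 := by
  decide

/-- `37` shifted pairs on shell `3`. [folklore] -/
theorem card_pairs_diag_shell3 :
    ((cube 2 ×ˢ cube 2).filter fun p : Site 3 × Site 3 =>
      max (((2:ℤ) • (fun _ => (1:ℤ) : Site 3) + p.1 - p.2) 0).natAbs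
        (max (((2:ℤ) • (fun _ => (1:ℤ) : Site 3) + p.1 - p.2) 1).natAbs
          (((2:ℤ) • (fun _ => (1:ℤ) : Site 3) + p.1 - p.2) 2).natAbs) = 3).card = 37 := by
  decide

/-! ### Exact block sums of `W₃` at `L = 2` -/

/-- `C_{W₃}(2,0) = 8·1 + 56·(1/3) = 80/3`. [folklore] -/
theorem blockSum_two_zero :
    (∑ x ∈ cube 2, ∑ y ∈ cube 2,
      (fun n : ℕ => if n = 0 then (1:ℝ) else 1 / (3 * (n:ℝ)))
        (max ((x - y) 0).natAbs (max ((x - y) 1).natAbs ((x - y) 2).natAbs))) = 80 / 3 := by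
  have hp : (∑ p ∈ cube 2 ×ˢ cube 2,
      (fun n : ℕ => if n = 0 then (1:ℝ) else 1 / (3 * (n:ℝ)))
        (max ((p.1 - p.2) 0).natAbs (max ((p.1 - p.2) 1).natAbs ((p.1 - p.2) 2).natAbs))) = 80 / 3 := by
    have h := Finset.sum_comp (s := cube 2 ×ˢ cube 2) (fun n : ℕ => if n = 0 then (1:ℝ) else 1 / (3 * (n:ℝ)))
      (fun p : Site 3 × Site 3 => max ((p.1 - p.2) 0).natAbs (max ((p.1 - p.2) 1).natAbs ((p.1 - p.2) 2).natAbs))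
    beta_reduce at h
    rw [h, image_sup_pairs, Finset.sum_insert (by decide), Finset.sum_singleton, card_pairs_shell0,
      card_pairs_shell1]
    norm_num
  rw [Finset.sum_product] at hp
  exact hp

/-- `C_{W₃}(2,(1,1,1)) = 1·(1/3) + 26·(1/6) + 37·(1/9) = 79/9`. [folklore] -/
theorem blockSum_two_diag :
    (∑ x ∈ cube 2, ∑ y ∈ cube 2,
      (fun n : ℕ => if n = 0 then (1:ℝ) else 1 / (3 * (n:ℝ)))
        (max (((2:ℤ) • (fun _ => (1:ℤ) : Site 3) + x - y) 0).natAbs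
          (max (((2:ℤ) • (fun _ => (1:ℤ) : Site 3) + x - y) 1).natAbs
            (((2:ℤ) • (fun _ => (1:ℤ) : Site 3) + x - y) 2).natAbs))) = 79 / 9 := by
  have hp : (∑ p ∈ cube 2 ×ˢ cube 2,
      (fun n : ℕ => if n = 0 then (1:ℝ) else 1 / (3 * (n:ℝ)))
        (max (((2:ℤ) • (fun _ => (1:ℤ) : Site 3) + p.1 - p.2) 0).natAbs
          (max (((2:ℤ) • (fun _ => (1:ℤ) : Site 3) + p.1 - p.2) 1).natAbs
            (((2:ℤ) • (fun _ => (1:ℤ) : Site 3) + p.1 - p.2) 2).natAbs))) = 79 / 9 := by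
    have h := Finset.sum_comp (s := cube 2 ×ˢ cube 2) (fun n : ℕ => if n = 0 then (1:ℝ) else 1 / (3 * (n:ℝ)))
      (fun p : Site 3 × Site 3 => max (((2:ℤ) • (fun _ => (1:ℤ) : Site 3) + p.1 - p.2) 0).natAbs
        (max (((2:ℤ) • (fun _ => (1:ℤ) : Site 3) + p.1 - p.2) 1).natAbs
          (((2:ℤ) • (fun _ => (1:ℤ) : Site 3) + p.1 - p.2) 2).natAbs))
    beta_reduce at h
    rw [h, image_sup_pairs_diag, Finset.sum_insert (by decide), Finset.sum_insert (by decide),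
      Finset.sum_singleton, card_pairs_diag_shell1, card_pairs_diag_shell2, card_pairs_diag_shell3]
    norm_num
  rw [Finset.sum_product] at hp
  exact hp

/-! ### The violation -/

/-- **THE AXIS-CALIBRATED WITNESS VIOLATES BM₂.** For `W₃(z) = w(‖z‖∞)`, `w(0) = 1`, `w(n) = 1/(3n)`, the
route's inequality (with `W₃` for `criticalTwoPoint 3`) fails at `L = 1`, `k = (1,1,1)`:
`(1/3)·(80/3) = 80/9 > 79/9`. [folklore] -/
theorem axisWitness_not_shape :
    ¬ ∀ L : ℕ, 1 ≤ L → ∀ k : Site 3,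
      (∑ x ∈ cube L, ∑ y ∈ cube L, (fun n : ℕ => if n = 0 then (1:ℝ) else 1 / (3 * (n:ℝ)))
          (max (((L:ℤ) • k + x - y) 0).natAbs
            (max (((L:ℤ) • k + x - y) 1).natAbs (((L:ℤ) • k + x - y) 2).natAbs))) *
        (∑ x ∈ cube (L + 1), ∑ y ∈ cube (L + 1), (fun n : ℕ => if n = 0 then (1:ℝ) else 1 / (3 * (n:ℝ)))
          (max ((((L + 1 : ℕ) : ℤ) • (0 : Site 3) + x - y) 0).natAbs
            (max ((((L + 1 : ℕ) : ℤ) • (0 : Site 3) + x - y) 1).natAbs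
              ((((L + 1 : ℕ) : ℤ) • (0 : Site 3) + x - y) 2).natAbs))) ≤
      (∑ x ∈ cube (L + 1), ∑ y ∈ cube (L + 1), (fun n : ℕ => if n = 0 then (1:ℝ) else 1 / (3 * (n:ℝ)))
          (max ((((L + 1 : ℕ) : ℤ) • k + x - y) 0).natAbs
            (max ((((L + 1 : ℕ) : ℤ) • k + x - y) 1).natAbs ((((L + 1 : ℕ) : ℤ) • k + x - y) 2).natAbs))) *
        (∑ x ∈ cube L, ∑ y ∈ cube L, (fun n : ℕ => if n = 0 then (1:ℝ) else 1 / (3 * (n:ℝ)))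
          (max (((L:ℤ) • (0 : Site 3) + x - y) 0).natAbs
            (max (((L:ℤ) • (0 : Site 3) + x - y) 1).natAbs (((L:ℤ) • (0 : Site 3) + x - y) 2).natAbs))) := by
  intro h
  set w : ℕ → ℝ := fun n : ℕ => if n = 0 then (1:ℝ) else 1 / (3 * (n:ℝ)) with hwdef
  have h1 := h 1 le_rfl (fun _ => (1:ℤ))
  simp only [cube_one_eq, Finset.sum_singleton, add_zero, sub_zero, smul_zero, Nat.reduceAdd,
    Nat.cast_ofNat] at h1
  have hw1 : w (max ((fun _ => (1:ℤ) : Site 3) 0).natAbs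
      (max ((fun _ => (1:ℤ) : Site 3) 1).natAbs ((fun _ => (1:ℤ) : Site 3) 2).natAbs)) = 1 / 3 := by
    simp [hwdef]
  have hw0 : w (max ((0 : Site 3) 0).natAbs (max ((0 : Site 3) 1).natAbs ((0 : Site 3) 2).natAbs)) = 1 := by
    simp [hwdef]
  have h0 : (∑ x ∈ cube 2, ∑ y ∈ cube 2,
      w (max ((0 + x - y) 0).natAbs (max ((0 + x - y) 1).natAbs ((0 + x - y) 2).natAbs))) = 80 / 3 := by
    simp only [zero_add]
    exact blockSum_two_zero
  have hd := blockSum_two_diag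
  have key : ∀ A B S T : ℝ, A = 1 / 3 → B = 1 → T = 80 / 3 → S = 79 / 9 → A * T ≤ S * B → False := by
    intro A B S T hA hB hT hS hle
    rw [hA, hB, hT, hS] at hle
    norm_num at hle
  exact key _ _ _ _ hw1 hw0 h0 hd h1

end Summit.CriticalPhenomena.Ising3DConformalLimit.MonotoneBlockingTwoNegative

end
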